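import Mathlib.RingTheory.PowerSeries.Substitution
import Mathlib.RingTheory.PowerSeries.Expand
import Mathlib.RingTheory.MvPowerSeries.Expand
import Mathlib.RingTheory.Ideal.Quotient.Operations
import Mathlib.Algebra.CharP.Basic
import Mathlib.Algebra.CharP.Quotient
import Mathlib.Algebra.CharP.Lemmas
import Mathlib.Data.Nat.Factorization.Basic
import Literature.RingTheory.FormalGroups.DegreeCongruence
import HarnessLib

/-!
# Hazewinkel's functional equation lemma, I: the defect, the Frobenius congruence, and part (iv)
# ([Hazewinkel 1978] Ch. I §2.1 (2.1.5)–(2.1.8), §2.2 Lemma (iv), §2.4)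

Topic `Literature/RingTheory/FormalGroups`; namespace `Literature.RingTheory.FormalGroups`.  One auxiliary `K`-valued
definition (`feDefectCoeff`, the "functional-equation defect" of a coefficient) + fully proved theorems; no named fact, no
instance, no notation, no `sorry`.  Cell `hodgecm-mathlib`, P6 «MOD programme» ROW 4B, letter L4B.3c𝒪 (lifting of formal
`𝒪`-module laws; road «universal law by the functional equation lemma»).  Sequel: `FunctionalEquationLemma.lean` (the lemma
itself, master form).

THE SETTING ([Hazewinkel1978] (2.1.1)–(2.1.4), principal-ideal case `𝔞 = ϖA`).  `K` a commutative ring, `A ≤ K` a subring,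
`σ : K → K` a ring endomorphism with `σ(A) ⊆ A`, `ϖ ∈ A` with `p ∈ ϖA` (`p` a prime), `q = p^f` (`f ≥ 1`),
`σ(a) ≡ a^q (mod ϖA)` for `a ∈ A`, and `s₁, s₂, … ∈ K` with `σ^k(s_i)·ϖ ∈ A`.  For a multivariate series `Θ ∈ K⟦X_τ⟧` the
DEFECT of `Θ` at `d` is `[X^d]Θ − Σ_{i ≥ 1} s_i [X^d](σ^i_*Θ)(X^{q^i})` (`feDefectCoeff`); `Θ` is of functional-equation type
when all its defects lie in `A` (for `Θ = ψ(X) = Σ a_n X^n`: `a_n − Σ_{q^i ∣ n} s_i σ^i(a_{n/q^i}) ∈ A`, i.e. `ψ = f_g` with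
`g ∈ A⟦X⟧` in the notation (2.1.5)–(2.1.8)).

* §1 series with coefficients in a subring (`coeff_mul_mem_subring`, `coeff_pow_mem_subring`);
* §2 `feDefectCoeff` (additive, `defect(c·Θ) = c·defect(Θ)` for `σ c = c`), the finite coefficient formula
  `coeff_psubst_eq_sum` (`[X^d]ψ(u) = Σ_{m ≤ |d|} a_m [X^d]u^m`);
* §3 `exists_coeff_pow_sub_expand_map_eq_mul` — the Frobenius congruence `e^{Q} ≡ (ρ_* e)(X^{Q}) (mod ϖ)` for `e ∈ A⟦X_τ⟧`,
  `ρ(a) ≡ a^Q (mod ϖ)`, `Q = p^F`; `exists_iterate_eq_pow_add` (`σ^i(a) ≡ a^{q^i}`);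
* §4 `exists_coeff_psubst_sub_psubst_eq_mul` — **part (iv) of the functional equation lemma** (`r = 1`, one direction): if
  the coefficients of `ψ` satisfy `a_m ϖ^v ∈ A` for `q^{v+1} ∤ m` (Hazewinkel's "`a_m 𝔞^{v_q(m)} ⊆ A`") and `α ≡ β (mod ϖ)` in
  `A⟦X_τ⟧` then `ψ(α) ≡ ψ(β) (mod ϖ)` — via `α^{q^v m'} ≡ β^{q^v m'} (mod ϖ^{v+1})`.

## References
* M. Hazewinkel, *Formal Groups and Applications*, Academic Press (1978), Ch. I §2.1 (2.1.1)–(2.1.8), §2.2 "The functional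
  equation lemma" (iv), §2.4 (2.4.1)–(2.4.6) (proof). [Hazewinkel1978]

## Design notes
"`x ∈ A⟦X⟧`" is spelled `∀ d, coeff d x ∈ A` (as in the tree's `DworkFrobeniusLift.lean`); congruences `mod ϖ` are
`∃ b ∈ A, … = ϖ * b` coefficientwise; integral series are moved to `MvPowerSeries τ A` (`MvPowerSeries.toSubring`) when ring
identities are needed (the Frobenius congruence is proved in `(A/ϖ)⟦X⟧` with Mathlib's `map_iterateFrobenius_expand`).
-/

noncomputable section

namespace Literature.RingTheory.FormalGroups

open MvPowerSeries

universe u v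

variable {K : Type u} [CommRing K] {τ : Type v}

/-! ## §1 Series with coefficients in a subring -/

section Subring

variable (A : Subring K)

/-- A series with coefficients in the subring `A` is the image of a series over `A`. [folklore] -/
private theorem mvExists_eq_map_subtype {x : MvPowerSeries τ K} (hx : ∀ d, coeff d x ∈ A) :
    ∃ X : MvPowerSeries τ A, map A.subtype X = x :=
  ⟨x.toSubring A hx, map_toSubring x A hx⟩

/-- The image of a series over `A` has coefficients in `A`. [folklore] -/
private theorem mvCoeff_map_subtype_mem (X : MvPowerSeries τ A) (d : τ →₀ ℕ) : coeff d (map A.subtype X) ∈ A := by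
  rw [coeff_map]; exact (coeff d X).2

/-- Products of series with coefficients in `A` have coefficients in `A` (`A⟦X⟧` is a subring of `K⟦X⟧`).
[cite: Hazewinkel1978, §2.4] -/
theorem coeff_mul_mem_subring {x y : MvPowerSeries τ K} (hx : ∀ d, coeff d x ∈ A) (hy : ∀ d, coeff d y ∈ A) :
    ∀ d, coeff d (x * y) ∈ A := by
  obtain ⟨X, rfl⟩ := mvExists_eq_map_subtype A hx
  obtain ⟨Y, rfl⟩ := mvExists_eq_map_subtype A hy
  intro d; rw [← map_mul]; exact mvCoeff_map_subtype_mem A _ d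

/-- Powers of series with coefficients in `A` have coefficients in `A` (`A⟦X⟧` is a subring of `K⟦X⟧`).
[cite: Hazewinkel1978, §2.4] -/
theorem coeff_pow_mem_subring {x : MvPowerSeries τ K} (hx : ∀ d, coeff d x ∈ A) (m : ℕ) :
    ∀ d, coeff d (x ^ m) ∈ A := by
  obtain ⟨X, rfl⟩ := mvExists_eq_map_subtype A hx
  intro d; rw [← map_pow]; exact mvCoeff_map_subtype_mem A _ d

end Subring

/-! ## §2 The defect and the finite coefficient formula for substitution -/

section Defect

/-- The **functional-equation defect** of the series `Θ ∈ K⟦X_τ⟧` at the exponent `d`: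
`[X^d]Θ − Σ_{i ≥ 1} s_i · [X^d] (σ^i_* Θ)(X_τ^{q^i})` (a finite sum: only `q^i ≤ |d|` contribute), i.e. the coefficient of `X^d`
in `Θ − Σ_i s_i σ^i_*Θ(X^{q^i})`.  `Θ` is of functional-equation type iff all its defects lie in `A`
([Hazewinkel1978] (2.1.5)–(2.1.8): `g = f − Σ s_i σ^i_* f(X^{q^i})`). [cite: Hazewinkel1978, §2.1 (2.1.5)–(2.1.8)] -/
def feDefectCoeff (σ : K →+* K) (q : ℕ) (hq : q ≠ 0) (s : ℕ → K) (Θ : MvPowerSeries τ K) (d : τ →₀ ℕ) : K :=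
  coeff d Θ - ∑ i ∈ Finset.Icc 1 d.degree, s i * coeff d (expand (q ^ i) (pow_ne_zero i hq) (map (σ ^ i) Θ))

variable (σ : K →+* K) (q : ℕ) (hq : q ≠ 0) (s : ℕ → K)

/-- Unfolding the defect. [cite: Hazewinkel1978, §2.1 (2.1.5)–(2.1.8)] -/
theorem feDefectCoeff_def (Θ : MvPowerSeries τ K) (d : τ →₀ ℕ) : feDefectCoeff σ q hq s Θ d =
    coeff d Θ - ∑ i ∈ Finset.Icc 1 d.degree, s i * coeff d (expand (q ^ i) (pow_ne_zero i hq) (map (σ ^ i) Θ)) := rfl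

/-- The defect is additive in `Θ`. [cite: Hazewinkel1978, §2.1 (2.1.5)–(2.1.8)] -/
theorem feDefectCoeff_add (Θ Θ' : MvPowerSeries τ K) (d : τ →₀ ℕ) :
    feDefectCoeff σ q hq s (Θ + Θ') d = feDefectCoeff σ q hq s Θ d + feDefectCoeff σ q hq s Θ' d := by
  simp only [feDefectCoeff, map_add, mul_add, Finset.sum_add_distrib]
  ring

/-- The defect is `σ`-semilinear for constants fixed by `σ`: `defect(c·Θ) = c · defect(Θ)` when `σ c = c`.
[cite: Hazewinkel1978, §2.1 (2.1.5)–(2.1.8)] -/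
theorem feDefectCoeff_C_mul {c : K} (hc : σ c = c) (Θ : MvPowerSeries τ K) (d : τ →₀ ℕ) :
    feDefectCoeff σ q hq s (C c * Θ) d = c * feDefectCoeff σ q hq s Θ d := by
  have hck : ∀ k : ℕ, (σ ^ k) c = c := fun k => by
    rw [RingHom.coe_pow]; exact Function.iterate_fixed hc k
  simp only [feDefectCoeff, map_mul, map_C, hck, expand_C, coeff_C_mul]
  rw [mul_sub, Finset.mul_sum]
  congr 1
  refine Finset.sum_congr rfl fun i _ => ?_
  ring

/-- The coefficient of `X^{Q•e}` in the expansion `Θ(X_τ^{Q})` is `[X^e]Θ` (and the coefficients off the multiples of `Q`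
vanish, Mathlib `MvPowerSeries.coeff_expand_of_not_dvd`); `σ^i_* f(X^{q^i})` of [Hazewinkel1978] (2.1.6).
[cite: Hazewinkel1978, §2.1 (2.1.6)] -/
theorem coeff_expand_of_eq_smul {Q : ℕ} (hQ : Q ≠ 0) (Θ : MvPowerSeries τ K) {d e : τ →₀ ℕ} (h : d = Q • e) :
    coeff d (expand Q hQ Θ) = coeff e Θ := by
  rw [h, coeff_expand_smul]

/-- **Finite coefficient formula**: for `u` without constant term, `[X^d] ψ(u) = Σ_{m ≤ |d|} a_m [X^d] u^m`.
[cite: Hazewinkel1978, §2.4] -/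
theorem coeff_psubst_eq_sum {u : MvPowerSeries τ K} (hu : constantCoeff u = 0) (ψ : PowerSeries K) (d : τ →₀ ℕ) :
    coeff d (PowerSeries.subst u ψ) =
      ∑ m ∈ Finset.range (d.degree + 1), PowerSeries.coeff m ψ * coeff d (u ^ m) := by
  rw [PowerSeries.coeff_subst (PowerSeries.HasSubst.of_constantCoeff_zero hu),
    finsum_eq_sum_of_support_subset _ (s := Finset.range (d.degree + 1))]
  · simp only [smul_eq_mul]
  · intro m hm
    rw [Function.mem_support] at hm
    rw [Finset.coe_range, Set.mem_Iio]
    by_contra hcon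
    apply hm
    have hlt : (d.degree : ℕ∞) < (u ^ m).order := lt_of_lt_of_le (by exact_mod_cast Nat.lt_of_succ_le (not_lt.mp hcon))
      (le_order_pow_of_constantCoeff_eq_zero m hu)
    rw [coeff_of_lt_order hlt, smul_zero]

end Defect

/-! ## §3 The Frobenius congruence `e^{Q} ≡ (ρ_* e)(X^{Q}) (mod ϖ)` -/

section Frobenius

variable (A : Subring K)

/-- **Frobenius congruence.**  Let `ρ` be a ring endomorphism of `K` preserving `A` with `ρ(a) ≡ a^{Q} (mod ϖA)` on `A`,
where `Q = p^F` for a prime `p ∈ ϖA`.  Then for every `e ∈ A⟦X_τ⟧`, `e^{Q} ≡ (ρ_* e)(X_τ^{Q}) (mod ϖ)` coefficientwise.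
(Reduce modulo `ϖ`: on `(A/ϖ)⟦X⟧`, `ρ̄` is the `F`-th iterate of Frobenius and `ē^{p^F} = (Frob^F_* ē)(X^{p^F})`.)
[cite: Hazewinkel1978, §2.4] -/
theorem exists_coeff_pow_sub_expand_map_eq_mul (ρ : K →+* K) {ϖ : K} (hϖ : ϖ ∈ A) {p : ℕ} (hp : p.Prime) (F : ℕ)
    {Q : ℕ} (hQ0 : Q ≠ 0) (hQ : Q = p ^ F)
    (hpϖ : ∃ w ∈ A, (p : K) = ϖ * w) (hρA : ∀ a ∈ A, ρ a ∈ A)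
    (hρ : ∀ a ∈ A, ∃ b ∈ A, ρ a = a ^ Q + ϖ * b)
    {e : MvPowerSeries τ K} (he : ∀ d, coeff d e ∈ A) (d : τ →₀ ℕ) :
    ∃ b ∈ A, coeff d (e ^ Q - expand Q hQ0 (map ρ e)) = ϖ * b := by
  classical
  subst hQ
  -- move to `A`
  set ϖA : A := ⟨ϖ, hϖ⟩ with hϖA
  obtain ⟨E, rfl⟩ := mvExists_eq_map_subtype A he
  let ρA : A →+* A := ρ.restrict A A hρA
  have hρA' : A.subtype.comp ρA = ρ.comp A.subtype := RingHom.ext fun a => rfl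
  -- the difference over `A`
  set D : MvPowerSeries τ A := E ^ (p ^ F) - expand (p ^ F) hQ0 (map ρA E) with hD
  have hmapD : map A.subtype D = (map A.subtype E) ^ (p ^ F) - expand (p ^ F) hQ0 (map ρ (map A.subtype E)) := by
    rw [hD, map_sub, map_pow, map_expand, map_map, hρA', ← map_map]
  have hcoeff : coeff d ((map A.subtype E) ^ (p ^ F) - expand (p ^ F) hQ0 (map ρ (map A.subtype E))) =
      ((coeff d D : A) : K) := by
    rw [← hmapD, coeff_map]; rfl
  rw [hcoeff]
  -- it suffices that `coeff d D ∈ span {ϖA}`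
  suffices hmem : coeff d D ∈ Ideal.span ({ϖA} : Set A) by
    obtain ⟨b, hb⟩ := Ideal.mem_span_singleton'.mp hmem
    exact ⟨b, b.2, by rw [← hb, Subring.coe_mul, mul_comm]⟩
  set I : Ideal A := Ideal.span ({ϖA} : Set A) with hI
  by_cases htop : I = ⊤
  · rw [htop]; exact Submodule.mem_top
  · -- reduce modulo `ϖ`
    haveI : Nontrivial (A ⧸ I) := Ideal.Quotient.nontrivial_iff.mpr htop
    have hpI : ((p : ℕ) : A ⧸ I) = 0 := by
      obtain ⟨w, hw, hpw⟩ := hpϖ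
      have : ((p : ℕ) : A) = ϖA * ⟨w, hw⟩ := Subtype.ext (by simpa using hpw)
      rw [← map_natCast (Ideal.Quotient.mk I), this, Ideal.Quotient.eq_zero_iff_mem]
      exact Ideal.mul_mem_right _ _ (Ideal.subset_span rfl)
    haveI hchar : CharP (A ⧸ I) p := (CharP.charP_iff_prime_eq_zero hp).mpr hpI
    haveI : ExpChar (A ⧸ I) p := ExpChar.prime hp
    rw [← Ideal.Quotient.eq_zero_iff_mem]
    -- `mk ∘ ρA = Frob^F ∘ mk`
    have hfrob : (Ideal.Quotient.mk I).comp ρA = (iterateFrobenius (A ⧸ I) p F).comp (Ideal.Quotient.mk I) := by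
      refine RingHom.ext fun a => ?_
      obtain ⟨b, hb, hab⟩ := hρ a a.2
      have hab' : ρA a = a ^ (p ^ F) + ϖA * ⟨b, hb⟩ := Subtype.ext (by
        change ρ a = _
        rw [hab]
        simp [hϖA])
      rw [RingHom.comp_apply, RingHom.comp_apply, hab', map_add, map_mul, iterateFrobenius_def, map_pow,
        Ideal.Quotient.eq_zero_iff_mem.mpr (Ideal.subset_span rfl : ϖA ∈ I), zero_mul, add_zero]
    have key : map (Ideal.Quotient.mk I) D = 0 := by
      rw [hD, map_sub, map_pow, map_expand, map_map, hfrob, ← map_map, ← map_expand,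
        map_iterateFrobenius_expand p hp.ne_zero, sub_self]
    have := congrArg (coeff d) key
    rwa [coeff_map, coeff_zero] at this

/-- Iterating the congruence `σ(a) ≡ a^q (mod ϖ)`: `σ^i(a) ≡ a^{q^i} (mod ϖ)` on `A`. [cite: Hazewinkel1978, §2.4] -/
theorem exists_iterate_eq_pow_add (σ : K →+* K) {ϖ : K} (q : ℕ) (hσA : ∀ a ∈ A, σ a ∈ A)
    (hσ : ∀ a ∈ A, ∃ b ∈ A, σ a = a ^ q + ϖ * b) (hσϖ : ∃ c ∈ A, σ ϖ = ϖ * c) :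
    ∀ (i : ℕ) (a : K), a ∈ A → ∃ b ∈ A, (σ ^ i) a = a ^ (q ^ i) + ϖ * b := by
  intro i
  induction i with
  | zero => intro a _; exact ⟨0, A.zero_mem, by simp⟩
  | succ i ih =>
    intro a ha
    obtain ⟨b, hb, hab⟩ := ih a ha
    obtain ⟨b', hb', hab'⟩ := hσ (a ^ (q ^ i)) (A.pow_mem ha _)
    obtain ⟨c, hc, hσc⟩ := hσϖ
    refine ⟨b' + c * σ b, A.add_mem hb' (A.mul_mem hc (hσA b hb)), ?_⟩
    rw [pow_succ', RingHom.coe_mul, Function.comp_apply, hab, map_add, map_mul, hab', hσc, pow_succ, pow_mul]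
    ring

end Frobenius

/-! ## §4 Part (iv): `α ≡ β (mod ϖ) ⇒ ψ(α) ≡ ψ(β) (mod ϖ)` -/

section PartFour

variable (A : Subring K)

/-- Raising a congruence to the `p`-th power: in any commutative `A`-algebra-like ring `S` with `p = ϖ w`,
`x = y + ϖ^r z` (`r ≥ 1`) gives `x^p = y^p + ϖ^{r+1} z'`. [cite: Hazewinkel1978, §2.4] -/
private theorem exists_pow_prime_eq_add {S : Type*} [CommRing S] (ϖ w : S) {p : ℕ}
    (hpw : (p : S) = ϖ * w) {r : ℕ} (hr : 1 ≤ r) (x y z : S) (h : x = y + ϖ ^ r * z) :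
    ∃ z' : S, x ^ p = y ^ p + ϖ ^ (r + 1) * z' := by
  -- `x^p - y^p = (x - y) · Σ x^i y^{p-1-i}` and `Σ x^i y^{p-1-i} ≡ p y^{p-1} (mod ϖ^r)`
  have hgeom : ∀ i : ℕ, ∃ t : S, x ^ i = y ^ i + ϖ ^ r * t := by
    intro i
    induction i with
    | zero => exact ⟨0, by simp⟩
    | succ i ih =>
      obtain ⟨t, ht⟩ := ih
      exact ⟨t * y + x ^ i * z, by rw [pow_succ, pow_succ, ht, h]; ring⟩
  have hsum : ∃ T : S, (∑ i ∈ Finset.range p, x ^ i * y ^ (p - 1 - i)) = (p : S) * y ^ (p - 1) + ϖ ^ r * T := by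
    have : ∀ i ∈ Finset.range p, ∃ t : S, x ^ i * y ^ (p - 1 - i) = y ^ (p - 1) + ϖ ^ r * t := by
      intro i hi
      rw [Finset.mem_range] at hi
      obtain ⟨t, ht⟩ := hgeom i
      refine ⟨t * y ^ (p - 1 - i), ?_⟩
      rw [ht, add_mul, ← pow_add, show i + (p - 1 - i) = p - 1 by omega]
      ring
    choose! t ht using this
    refine ⟨∑ i ∈ Finset.range p, t i, ?_⟩
    rw [Finset.sum_congr rfl ht, Finset.sum_add_distrib, Finset.sum_const, Finset.card_range, Finset.mul_sum]
    simp
  obtain ⟨T, hT⟩ := hsum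
  have hxy : x ^ p - y ^ p = (∑ i ∈ Finset.range p, x ^ i * y ^ (p - 1 - i)) * (x - y) :=
    (Commute.geom_sum₂_mul (Commute.all x y) p).symm
  refine ⟨z * (w * y ^ (p - 1) + ϖ ^ (r - 1) * T), ?_⟩
  have hϖr : ϖ ^ r = ϖ * ϖ ^ (r - 1) := by rw [← pow_succ', Nat.sub_add_cancel hr]
  rw [← sub_eq_iff_eq_add', hxy, hT, h, add_sub_cancel_left, hpw, pow_succ, hϖr]
  ring

/-- Raising a congruence to the power `p^F` (`F ≥ 1`): `x = y + ϖ^r z` (`r ≥ 1`) gives `x^{p^F} = y^{p^F} + ϖ^{r+1} z'`.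
[cite: Hazewinkel1978, §2.4] -/
private theorem exists_pow_prime_pow_eq_add {S : Type*} [CommRing S] (ϖ w : S) {p : ℕ}
    (hpw : (p : S) = ϖ * w) {r : ℕ} (hr : 1 ≤ r) :
    ∀ (F : ℕ), 1 ≤ F → ∀ (x y z : S), x = y + ϖ ^ r * z → ∃ z' : S, x ^ (p ^ F) = y ^ (p ^ F) + ϖ ^ (r + 1) * z'
  | 0, hF, _, _, _, _ => absurd hF (by omega)
  | 1, _, x, y, z, h => by simpa using exists_pow_prime_eq_add ϖ w hpw hr x y z h
  | (F + 2), _, x, y, z, h => by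
    obtain ⟨z', hz'⟩ := exists_pow_prime_pow_eq_add ϖ w hpw hr (F + 1) (by omega) x y z h
    obtain ⟨z'', hz''⟩ := exists_pow_prime_eq_add ϖ w hpw (by omega : 1 ≤ r + 1) _ _ _ hz'
    exact ⟨ϖ * z'', by rw [pow_succ, pow_mul, hz'']; ring⟩

/-- Raising a congruence to the power `q^v = (p^f)^v` (`f ≥ 1`): `x = y + ϖ z` gives `x^{q^v} = y^{q^v} + ϖ^{v+1} z'`.
[cite: Hazewinkel1978, §2.4] -/
private theorem exists_pow_pow_eq_add {S : Type*} [CommRing S] (ϖ w : S) {p : ℕ}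
    (hpw : (p : S) = ϖ * w) {f : ℕ} (hf : 1 ≤ f) (x y z : S) (h : x = y + ϖ * z) :
    ∀ v : ℕ, ∃ z' : S, x ^ ((p ^ f) ^ v) = y ^ ((p ^ f) ^ v) + ϖ ^ (v + 1) * z'
  | 0 => ⟨z, by simpa using h⟩
  | (v + 1) => by
    obtain ⟨z', hz'⟩ := exists_pow_pow_eq_add ϖ w hpw hf x y z h v
    obtain ⟨z'', hz''⟩ := exists_pow_prime_pow_eq_add ϖ w hpw (by omega : 1 ≤ v + 1) f hf _ _ _ hz'
    exact ⟨z'', by rw [pow_succ, pow_mul, hz'', ← pow_mul]⟩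

/-- And then to any multiple: `x = y + ϖ z` gives `x^{q^v m} = y^{q^v m} + ϖ^{v+1} z'`. [cite: Hazewinkel1978, §2.4] -/
private theorem exists_pow_pow_mul_eq_add {S : Type*} [CommRing S] (ϖ w : S) {p : ℕ}
    (hpw : (p : S) = ϖ * w) {f : ℕ} (hf : 1 ≤ f) (v : ℕ) (x y z : S) (h : x = y + ϖ * z) :
    ∀ m : ℕ, ∃ z' : S, x ^ ((p ^ f) ^ v * m) = y ^ ((p ^ f) ^ v * m) + ϖ ^ (v + 1) * z'
  | 0 => ⟨0, by simp⟩
  | (m + 1) => by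
    obtain ⟨z', hz'⟩ := exists_pow_pow_eq_add ϖ w hpw hf x y z h v
    obtain ⟨t, ht⟩ := exists_pow_pow_mul_eq_add ϖ w hpw hf v x y z h m
    refine ⟨t * y ^ ((p ^ f) ^ v) + x ^ ((p ^ f) ^ v * m) * z', ?_⟩
    rw [mul_add, mul_one, pow_add, pow_add, ht, hz']
    ring

/-- **Functional equation lemma, part (iv)** (`r = 1`, one direction): let `ψ = Σ a_m X^m ∈ K⟦X⟧` have coefficients with
`a_m ϖ^v ∈ A` whenever `q^{v+1} ∤ m` (`q = p^f`, `f ≥ 1`, `p = ϖ w` with `w ∈ A`).  If `α, β ∈ A⟦X_τ⟧` have no constant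
term and `α ≡ β (mod ϖ)`, then `ψ(α) ≡ ψ(β) (mod ϖ)`.  (`a_m(α^m − β^m) ∈ a_m ϖ^{1+v_q(m)} A⟦X⟧ ⊆ ϖA⟦X⟧`.)
[cite: Hazewinkel1978, §2.2 Lemma (iv), §2.4] -/
theorem exists_coeff_psubst_sub_psubst_eq_mul {ϖ w : K} (hϖ : ϖ ∈ A) (hw : w ∈ A) {p : ℕ} (hp : p.Prime)
    (hpw : (p : K) = ϖ * w) {f : ℕ} (hf : 1 ≤ f) (ψ : PowerSeries K)
    (hψ : ∀ m v : ℕ, ¬ (p ^ f) ^ (v + 1) ∣ m → PowerSeries.coeff m ψ * ϖ ^ v ∈ A)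
    {α β : MvPowerSeries τ K} (hα0 : constantCoeff α = 0) (hβ0 : constantCoeff β = 0)
    (hα : ∀ d, coeff d α ∈ A) (hβ : ∀ d, coeff d β ∈ A) (hαβ : ∀ d, ∃ b ∈ A, coeff d (α - β) = ϖ * b) (d : τ →₀ ℕ) :
    ∃ b ∈ A, coeff d (PowerSeries.subst α ψ - PowerSeries.subst β ψ) = ϖ * b := by
  classical
  set q := p ^ f with hq
  have hq2 : 2 ≤ q := le_trans hp.two_le (by rw [hq]; exact Nat.le_self_pow (by omega) p)
  -- move to `A⟦X⟧`
  obtain ⟨aA, rfl⟩ := mvExists_eq_map_subtype A hα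
  obtain ⟨bA, rfl⟩ := mvExists_eq_map_subtype A hβ
  choose! c hc using hαβ
  set zA : MvPowerSeries τ A := fun d => ⟨c d, (hc d).1⟩ with hzA
  set ϖA : A := ⟨ϖ, hϖ⟩ with hϖA
  set wA : A := ⟨w, hw⟩ with hwA
  have hpwA : (p : MvPowerSeries τ A) = C ϖA * C wA := by
    rw [← map_natCast (C (σ := τ) (R := A)), ← map_mul]
    congr 1
    exact Subtype.ext (by simpa using hpw)
  have hz : ∀ e, ((coeff e zA : A) : K) = c e := fun e => rfl
  have hab : aA = bA + C ϖA * zA := by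
    ext e
    have h1 := (hc e).2
    rw [map_sub, coeff_map, coeff_map] at h1
    change ((coeff e aA : A) : K) - ((coeff e bA : A) : K) = ϖ * c e at h1
    rw [map_add, coeff_C_mul, Subring.coe_add, Subring.coe_mul, hz]
    linear_combination h1
  -- the coefficient formula
  rw [map_sub, coeff_psubst_eq_sum (by rw [constantCoeff_map, ← coeff_zero_eq_constantCoeff] ; simpa using hα0) ψ d,
    coeff_psubst_eq_sum (by simpa using hβ0) ψ d, ← Finset.sum_sub_distrib]
  -- each term is `ϖ ·` an element of `A`
  have hterm : ∀ m ∈ Finset.range (d.degree + 1), ∃ b ∈ A,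
      PowerSeries.coeff m ψ * coeff d ((map A.subtype aA) ^ m) -
        PowerSeries.coeff m ψ * coeff d ((map A.subtype bA) ^ m) = ϖ * b := by
    intro m _
    rcases Nat.eq_zero_or_pos m with rfl | hm
    · exact ⟨0, A.zero_mem, by simp⟩
    obtain ⟨v, m', hm', hmeq⟩ := Nat.exists_eq_pow_mul_and_not_dvd hm.ne' q (by omega)
    obtain ⟨z', hz'⟩ := exists_pow_pow_mul_eq_add (C ϖA) (C wA) hpwA hf v aA bA zA hab m'
    have hndvd : ¬ q ^ (v + 1) ∣ m := by
      rintro ⟨t, ht⟩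
      apply hm'
      refine ⟨t, Nat.eq_of_mul_eq_mul_left (show 0 < q ^ v from pow_pos (by omega) v) ?_⟩
      rw [← hmeq, ht, pow_succ, mul_assoc]
    have hA := hψ m v hndvd
    refine ⟨PowerSeries.coeff m ψ * ϖ ^ v * ((coeff d z' : A) : K), A.mul_mem hA (coeff d z').2, ?_⟩
    rw [← mul_sub, ← map_pow, ← map_pow, coeff_map, coeff_map, hmeq, hz', map_add,
      ← map_pow (C (σ := τ) (R := ↥A)), coeff_C_mul]
    simp only [map_add, map_mul, map_pow, Subring.coe_subtype, hϖA]
    rw [pow_succ]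
    ring
  -- sum up
  have key : ∀ t : Finset ℕ, (∀ m ∈ t, ∃ b ∈ A,
      PowerSeries.coeff m ψ * coeff d ((map A.subtype aA) ^ m) -
        PowerSeries.coeff m ψ * coeff d ((map A.subtype bA) ^ m) = ϖ * b) →
      ∃ b ∈ A, (∑ m ∈ t, (PowerSeries.coeff m ψ * coeff d ((map A.subtype aA) ^ m) -
        PowerSeries.coeff m ψ * coeff d ((map A.subtype bA) ^ m))) = ϖ * b := by
    intro t
    induction t using Finset.induction_on with
    | empty => exact fun _ => ⟨0, A.zero_mem, by simp⟩
    | insert m t hmt ih =>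
      intro ht
      obtain ⟨b₁, hb₁, h₁⟩ := ih fun m' hm' => ht m' (Finset.mem_insert_of_mem hm')
      obtain ⟨b₂, hb₂, h₂⟩ := ht m (Finset.mem_insert_self m t)
      exact ⟨b₂ + b₁, A.add_mem hb₂ hb₁, by rw [Finset.sum_insert hmt, h₁, h₂, mul_add]⟩
  exact key _ hterm

end PartFour

end Literature.RingTheory.FormalGroups
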